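import Mathlib
import Summits.NavierStokesRegularity.NavierStokesRegularity.Theorems.EfficiencyFloorEfficiencyConcentrationTools
import HarnessLib

/-!
# Efficiency ⇒ concentration, II: the localised estimates
  (helper file for item stmt-NavierStokesRegularity-23111, `EfficiencyFloor.EfficiencyConcentration`)

With `ω = curl v`, `ψ_a(x) = χ(R⁻¹(x − a))` and `g_a = ψ_a • ω` (part I,
`…EfficiencyConcentrationTools`):

* `ofReal_stretching_le` — `S = ∫⟨ω, Dv ω⟩ ≤ ∫ |ω|² ‖Dv‖` (in `[0, ∞]`);
* `lintegral_bump_sq_mul_le` — the per-centre Cauchy–Schwarz step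
  `∫ ψ_a² |ω|² ‖Dv‖ ≤ (∫‖g_a‖⁴)^{1/2} (∫_{closedBall a (rOut R)} ‖Dv‖²)^{1/2}`;
* `lintegral_loc_pow_four_le` — the per-centre `L⁴` bound
  `∫‖g_a‖⁴ ≤ 2K³ √μ √(2E_max) · ∫_{closedBall a (rOut R)} (‖Dω‖² + (L/R)²|ω|²)` when the ball carries
  enstrophy `≤ μ` and weighted `H¹`-mass `≤ E_max` (Gagliardo–Nirenberg `L⁴` + Leibniz);
* `lintegral_lintegral_ball_fderiv_le` — `∫_a ∫_{closedBall a r} ‖Dv‖² ≤ |B_r| ∫|curl v|²`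
  (Tonelli + the `L²` `div`–`curl` estimate of the tree);
* `final_algebra` — the closing real inequality.

HONEST FRAMING: elementary real analysis on `ℝ³`; nothing here bears on Navier–Stokes regularity.

References: L. C. Evans, *Partial Differential Equations* (2010), §5.6.1; the localisation device is
folklore (cf. the concentration–compactness dichotomy at a fixed scale).
-/

noncomputable section

set_option linter.dupNamespace false

namespace Summit.NavierStokesRegularity.NavierStokesRegularity.Theorems

namespace EfficiencyConcentration

open MeasureTheory Metric Set Filter Topology Function
open scoped ENNReal NNReal InnerProductSpace
open Literature.Analysis.FluidPDE

section Estimates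

variable {v : (EuclideanSpace ℝ (Fin 3)) → (EuclideanSpace ℝ (Fin 3))}

/-- Powers of the norm of a continuous compactly supported field are integrable. [folklore] -/
theorem integrable_norm_pow_of_hasCompactSupport {F : Type*} [NormedAddCommGroup F]
    {f : EuclideanSpace ℝ (Fin 3) → F} (hf : Continuous f) (hc : HasCompactSupport f)
    (n : ℕ) (hn : n ≠ 0) : Integrable (fun x => ‖f x‖ ^ n) :=
  ((hf.norm).pow n).integrable_of_hasCompactSupport
    (hc.norm.comp_left (g := fun r : ℝ => r ^ n) (zero_pow hn))

/-- `ofReal S ≤ ∫ |ω|² ‖Dv‖` for the stretching `S = ∫⟨ω, Dv ω⟩` (`ω = curl v`; Bochner integral on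
the left, lower Lebesgue integral on the right, no integrability needed). [folklore] -/
theorem ofReal_stretching_le (v : (EuclideanSpace ℝ (Fin 3)) → (EuclideanSpace ℝ (Fin 3))) :
    ENNReal.ofReal (∫ x, ⟪curl v x, fderiv ℝ v x (curl v x)⟫_ℝ) ≤
      ∫⁻ x, ‖curl v x‖ₑ ^ 2 * ‖fderiv ℝ v x‖ₑ := by
  calc ENNReal.ofReal (∫ x, ⟪curl v x, fderiv ℝ v x (curl v x)⟫_ℝ)
      ≤ ‖∫ x, ⟪curl v x, fderiv ℝ v x (curl v x)⟫_ℝ‖ₑ := by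
        rw [Real.enorm_eq_ofReal_abs]
        exact ENNReal.ofReal_le_ofReal (le_abs_self _)
    _ ≤ ∫⁻ x, ‖⟪curl v x, fderiv ℝ v x (curl v x)⟫_ℝ‖ₑ := enorm_integral_le_lintegral_enorm _
    _ ≤ ∫⁻ x, ‖curl v x‖ₑ ^ 2 * ‖fderiv ℝ v x‖ₑ := by
        refine lintegral_mono fun x => ?_
        rw [Real.enorm_eq_ofReal_abs, ← ofReal_norm, ← ofReal_norm,
          ← ENNReal.ofReal_pow (norm_nonneg _), ← ENNReal.ofReal_mul (by positivity)]
        refine ENNReal.ofReal_le_ofReal ?_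
        calc |⟪curl v x, fderiv ℝ v x (curl v x)⟫_ℝ|
            ≤ ‖curl v x‖ * ‖fderiv ℝ v x (curl v x)‖ := abs_real_inner_le_norm _ _
          _ ≤ ‖curl v x‖ * (‖fderiv ℝ v x‖ * ‖curl v x‖) :=
              mul_le_mul_of_nonneg_left (ContinuousLinearMap.le_opNorm _ _) (norm_nonneg _)
          _ = ‖curl v x‖ ^ 2 * ‖fderiv ℝ v x‖ := by ring

/-- Pointwise: `ψ_a(x)² |ω(x)|² ‖Dv(x)‖ ≤ ‖g_a(x)‖² · 1_{closedBall a (rOut R)}(x) ‖Dv(x)‖`.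
[folklore] -/
theorem bump_sq_mul_le (χ : ContDiffBump (0 : (EuclideanSpace ℝ (Fin 3)))) {R : ℝ} (hR : 0 < R) (a x : (EuclideanSpace ℝ (Fin 3))) :
    ENNReal.ofReal ((χ : (EuclideanSpace ℝ (Fin 3)) → ℝ) (R⁻¹ • (x - a)) ^ 2) * (‖curl v x‖ₑ ^ 2 * ‖fderiv ℝ v x‖ₑ) ≤
      ‖(χ : (EuclideanSpace ℝ (Fin 3)) → ℝ) (R⁻¹ • (x - a)) • curl v x‖ₑ ^ 2 *
        (closedBall a (χ.rOut * R)).indicator (fun y => ‖fderiv ℝ v y‖ₑ) x := by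
  have hψ0 := bump_nonneg χ R a x
  have hsq : ‖(χ : (EuclideanSpace ℝ (Fin 3)) → ℝ) (R⁻¹ • (x - a)) • curl v x‖ₑ ^ 2 =
      ENNReal.ofReal ((χ : (EuclideanSpace ℝ (Fin 3)) → ℝ) (R⁻¹ • (x - a)) ^ 2) * ‖curl v x‖ₑ ^ 2 := by
    rw [enorm_smul, mul_pow, Real.enorm_eq_ofReal hψ0, ENNReal.ofReal_pow hψ0]
  by_cases hx : x ∈ closedBall a (χ.rOut * R)
  · rw [indicator_of_mem hx, hsq, mul_assoc]
  · rw [bump_eq_zero χ hR fun h => hx (ball_subset_closedBall h)]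
    simp

/-- **Per-centre Cauchy–Schwarz**:
`∫ ψ_a² |ω|² ‖Dv‖ ≤ (∫‖g_a‖⁴)^{1/2} (∫ 1_{closedBall a (rOut R)} ‖Dv‖²)^{1/2}`. [folklore] -/
theorem lintegral_bump_sq_mul_le (χ : ContDiffBump (0 : (EuclideanSpace ℝ (Fin 3)))) {R : ℝ} (hR : 0 < R) (a : (EuclideanSpace ℝ (Fin 3)))
    (hω : Continuous (curl v)) (hDv : Continuous (fderiv ℝ v)) :
    ∫⁻ x, ENNReal.ofReal ((χ : (EuclideanSpace ℝ (Fin 3)) → ℝ) (R⁻¹ • (x - a)) ^ 2) * (‖curl v x‖ₑ ^ 2 * ‖fderiv ℝ v x‖ₑ) ≤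
      (∫⁻ x, ‖(χ : (EuclideanSpace ℝ (Fin 3)) → ℝ) (R⁻¹ • (x - a)) • curl v x‖ₑ ^ 4) ^ (1 / 2 : ℝ) *
        (∫⁻ x, (closedBall a (χ.rOut * R)).indicator (fun y => ‖fderiv ℝ v y‖ₑ ^ 2) x) ^
          (1 / 2 : ℝ) := by
  set f : (EuclideanSpace ℝ (Fin 3)) → ℝ≥0∞ := fun x => ‖(χ : (EuclideanSpace ℝ (Fin 3)) → ℝ) (R⁻¹ • (x - a)) • curl v x‖ₑ ^ 2 with hf
  set g : (EuclideanSpace ℝ (Fin 3)) → ℝ≥0∞ := fun x => (closedBall a (χ.rOut * R)).indicator (fun y => ‖fderiv ℝ v y‖ₑ) x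
    with hg
  have hfm : AEMeasurable f volume :=
    ((((contDiff_bump χ R a (n := 0)).continuous.smul hω).measurable.enorm).pow_const _).aemeasurable
  have hgm : AEMeasurable g volume :=
    ((hDv.measurable.enorm).indicator measurableSet_closedBall).aemeasurable
  have H := ENNReal.lintegral_mul_le_Lp_mul_Lq volume Real.HolderConjugate.two_two hfm hgm
  have hf2 : ∀ x, f x ^ (2 : ℝ) = ‖(χ : (EuclideanSpace ℝ (Fin 3)) → ℝ) (R⁻¹ • (x - a)) • curl v x‖ₑ ^ 4 := by
    intro x
    simp only [hf]
    rw [show (2 : ℝ) = ((2 : ℕ) : ℝ) by norm_num, ENNReal.rpow_natCast, ← pow_mul]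
  have hg2 : ∀ x, g x ^ (2 : ℝ) =
      (closedBall a (χ.rOut * R)).indicator (fun y => ‖fderiv ℝ v y‖ₑ ^ 2) x := by
    intro x
    simp only [hg]
    rw [show (2 : ℝ) = ((2 : ℕ) : ℝ) by norm_num, ENNReal.rpow_natCast]
    by_cases hx : x ∈ closedBall a (χ.rOut * R)
    · rw [indicator_of_mem hx, indicator_of_mem hx]
    · rw [indicator_of_notMem hx, indicator_of_notMem hx, zero_pow two_ne_zero]
  simp_rw [Pi.mul_apply, hf2, hg2] at H
  refine (lintegral_mono fun x => ?_).trans H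
  exact bump_sq_mul_le χ hR a x

/-- **Per-centre `L⁴` bound.** If `closedBall a (rOut R)` carries enstrophy `∫|ω|² ≤ μ` and weighted
mass `E_a = ∫ (‖Dω‖² + (L/R)²|ω|²) ≤ E_max`, then
`∫‖g_a‖⁴ ≤ 2 K³ √μ √(2 E_max) · E_a` (`K` Mathlib's Sobolev constant). [folklore] -/
theorem integral_loc_pow_four_le (χ : ContDiffBump (0 : (EuclideanSpace ℝ (Fin 3)))) {R L μ Emax : ℝ} (hR : 0 < R)
    (hL : ∀ y, ‖fderiv ℝ (χ : (EuclideanSpace ℝ (Fin 3)) → ℝ) y‖ ≤ L) (a : (EuclideanSpace ℝ (Fin 3))) (hω : ContDiff ℝ 1 (curl v))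
    (hμ : ∫ x in closedBall a (χ.rOut * R), ‖curl v x‖ ^ 2 ≤ μ)
    (hE : ∫ x in closedBall a (χ.rOut * R),
      (‖fderiv ℝ (curl v) x‖ ^ 2 + (L / R) ^ 2 * ‖curl v x‖ ^ 2) ≤ Emax) :
    ∫ x, ‖(χ : (EuclideanSpace ℝ (Fin 3)) → ℝ) (R⁻¹ • (x - a)) • curl v x‖ ^ 4 ≤
      2 * (SNormLESNormFDerivOfEqConst (EuclideanSpace ℝ (Fin 3)) (volume : Measure (EuclideanSpace ℝ (Fin 3))) 2 : ℝ) ^ 3 * Real.sqrt μ *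
        Real.sqrt (2 * Emax) *
        ∫ x in closedBall a (χ.rOut * R),
          (‖fderiv ℝ (curl v) x‖ ^ 2 + (L / R) ^ 2 * ‖curl v x‖ ^ 2) := by
  set K : ℝ := (SNormLESNormFDerivOfEqConst (EuclideanSpace ℝ (Fin 3)) (volume : Measure (EuclideanSpace ℝ (Fin 3))) 2 : ℝ) with hK
  have hK0 : 0 ≤ K := NNReal.coe_nonneg _
  set I2 : ℝ := ∫ x, ‖(χ : (EuclideanSpace ℝ (Fin 3)) → ℝ) (R⁻¹ • (x - a)) • curl v x‖ ^ 2 with hI2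
  set D : ℝ := ∫ x, ‖fderiv ℝ (fun x : (EuclideanSpace ℝ (Fin 3)) => (χ : (EuclideanSpace ℝ (Fin 3)) → ℝ) (R⁻¹ • (x - a)) • curl v x) x‖ ^ 2
    with hD
  set E : ℝ := ∫ x in closedBall a (χ.rOut * R),
      (‖fderiv ℝ (curl v) x‖ ^ 2 + (L / R) ^ 2 * ‖curl v x‖ ^ 2) with hEdef
  have hωc : Continuous (curl v) := hω.continuous
  have hDωc : Continuous (fderiv ℝ (curl v)) := hω.continuous_fderiv one_ne_zero
  have hI20 : 0 ≤ I2 := integral_nonneg fun x => by positivity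
  have hD0 : 0 ≤ D := integral_nonneg fun x => by positivity
  have hE0 : 0 ≤ E := setIntegral_nonneg measurableSet_closedBall fun x _ => by positivity
  -- `I2 ≤ μ`
  have hcpt : IsCompact (closedBall a (χ.rOut * R)) := isCompact_closedBall _ _
  have hint_ind : Integrable ((closedBall a (χ.rOut * R)).indicator fun y => ‖curl v y‖ ^ 2) :=
    (integrable_indicator_iff measurableSet_closedBall).2
      ((hωc.norm.pow 2).continuousOn.integrableOn_compact hcpt)
  have hgc := hasCompactSupport_loc (v := v) χ hR a
  have hgcont : Continuous (fun x : (EuclideanSpace ℝ (Fin 3)) => (χ : (EuclideanSpace ℝ (Fin 3)) → ℝ) (R⁻¹ • (x - a)) • curl v x) :=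
    (contDiff_loc χ R a hω).continuous
  have hI2μ : I2 ≤ μ := by
    calc I2 ≤ ∫ x, (closedBall a (χ.rOut * R)).indicator (fun y => ‖curl v y‖ ^ 2) x :=
          integral_mono_of_nonneg (ae_of_all _ fun x => by positivity) hint_ind
            (ae_of_all _ fun x => norm_loc_sq_le_indicator χ hR a x)
      _ = ∫ x in closedBall a (χ.rOut * R), ‖curl v x‖ ^ 2 :=
          integral_indicator measurableSet_closedBall
      _ ≤ μ := hμ
  -- `D ≤ 2E`
  have hint_e : Integrable ((closedBall a (χ.rOut * R)).indicator fun y =>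
      2 * (‖fderiv ℝ (curl v) y‖ ^ 2 + (L / R) ^ 2 * ‖curl v y‖ ^ 2)) :=
    (integrable_indicator_iff measurableSet_closedBall).2
      ((continuous_const.mul ((hDωc.norm.pow 2).add
        (continuous_const.mul (hωc.norm.pow 2)))).continuousOn.integrableOn_compact hcpt)
  have hD2E : D ≤ 2 * E := by
    calc D ≤ ∫ x, (closedBall a (χ.rOut * R)).indicator (fun y =>
            2 * (‖fderiv ℝ (curl v) y‖ ^ 2 + (L / R) ^ 2 * ‖curl v y‖ ^ 2)) x :=
          integral_mono_of_nonneg (ae_of_all _ fun x => by positivity) hint_e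
            (ae_of_all _ fun x => norm_fderiv_loc_sq_le χ hR hL a x hω)
      _ = ∫ x in closedBall a (χ.rOut * R),
            2 * (‖fderiv ℝ (curl v) x‖ ^ 2 + (L / R) ^ 2 * ‖curl v x‖ ^ 2) :=
          integral_indicator measurableSet_closedBall
      _ = 2 * E := by rw [hEdef, integral_const_mul]
  -- Gagliardo–Nirenberg and bookkeeping
  have hGN := integral_norm_loc_pow_four_le (v := v) χ hR a hω
  rw [← hK, ← hI2, ← hD] at hGN
  have hμ0 : 0 ≤ μ := hI20.trans hI2μ
  have hEmax : E ≤ Emax := hE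
  have h1 : I2 ^ (1 / 2 : ℝ) ≤ Real.sqrt μ := by
    rw [← Real.sqrt_eq_rpow]; exact Real.sqrt_le_sqrt hI2μ
  have h2 : D ^ (3 / 2 : ℝ) ≤ Real.sqrt (2 * Emax) * (2 * E) := by
    have h2E0 : 0 ≤ 2 * E := by positivity
    calc D ^ (3 / 2 : ℝ) ≤ (2 * E) ^ (3 / 2 : ℝ) := Real.rpow_le_rpow hD0 hD2E (by norm_num)
      _ = Real.sqrt (2 * E) * (2 * E) := by
          rw [show (3 / 2 : ℝ) = 1 / 2 + 1 by norm_num, Real.rpow_add' h2E0 (by norm_num),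
            Real.rpow_one, Real.sqrt_eq_rpow]
      _ ≤ Real.sqrt (2 * Emax) * (2 * E) :=
          mul_le_mul_of_nonneg_right (Real.sqrt_le_sqrt (by linarith)) h2E0
  calc ∫ x, ‖(χ : (EuclideanSpace ℝ (Fin 3)) → ℝ) (R⁻¹ • (x - a)) • curl v x‖ ^ 4
      ≤ K ^ 3 * I2 ^ (1 / 2 : ℝ) * D ^ (3 / 2 : ℝ) := hGN
    _ ≤ K ^ 3 * Real.sqrt μ * (Real.sqrt (2 * Emax) * (2 * E)) := by
        gcongr
    _ = 2 * K ^ 3 * Real.sqrt μ * Real.sqrt (2 * Emax) * E := by ring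

/-- `[0,∞]` form of the per-centre `L⁴` bound:
`∫‖g_a‖ₑ⁴ ≤ ofReal(2K³√μ√(2E_max)) · ∫ 1_{closedBall a (rOut R)} ofReal(‖Dω‖² + (L/R)²|ω|²)`.
[folklore] -/
theorem lintegral_loc_pow_four_le (χ : ContDiffBump (0 : (EuclideanSpace ℝ (Fin 3))))
    {R L μ Emax : ℝ} (hR : 0 < R)
    (hL : ∀ y, ‖fderiv ℝ (χ : (EuclideanSpace ℝ (Fin 3)) → ℝ) y‖ ≤ L) (a : EuclideanSpace ℝ (Fin 3))
    (hω : ContDiff ℝ 1 (curl v))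
    (hμ : ∫ x in closedBall a (χ.rOut * R), ‖curl v x‖ ^ 2 ≤ μ)
    (hE : ∫ x in closedBall a (χ.rOut * R),
      (‖fderiv ℝ (curl v) x‖ ^ 2 + (L / R) ^ 2 * ‖curl v x‖ ^ 2) ≤ Emax) :
    ∫⁻ x, ‖(χ : (EuclideanSpace ℝ (Fin 3)) → ℝ) (R⁻¹ • (x - a)) • curl v x‖ₑ ^ 4 ≤
      ENNReal.ofReal (2 * (SNormLESNormFDerivOfEqConst (EuclideanSpace ℝ (Fin 3))
          (volume : Measure (EuclideanSpace ℝ (Fin 3))) 2 : ℝ) ^ 3 * Real.sqrt μ *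
          Real.sqrt (2 * Emax)) *
        ∫⁻ x, (closedBall a (χ.rOut * R)).indicator
          (fun y => ENNReal.ofReal (‖fderiv ℝ (curl v) y‖ ^ 2 + (L / R) ^ 2 * ‖curl v y‖ ^ 2)) x := by
  have hreal := integral_loc_pow_four_le (v := v) χ hR hL a hω hμ hE
  have hωc : Continuous (curl v) := hω.continuous
  have hDωc : Continuous (fderiv ℝ (curl v)) := hω.continuous_fderiv one_ne_zero
  have hgc := hasCompactSupport_loc (v := v) χ hR a
  have hgcont : Continuous
      (fun x : EuclideanSpace ℝ (Fin 3) => (χ : (EuclideanSpace ℝ (Fin 3)) → ℝ) (R⁻¹ • (x - a)) •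
        curl v x) := (contDiff_loc χ R a hω).continuous
  have h4i : Integrable (fun x => ‖(χ : (EuclideanSpace ℝ (Fin 3)) → ℝ) (R⁻¹ • (x - a)) •
      curl v x‖ ^ 4) :=
    integrable_norm_pow_of_hasCompactSupport hgcont hgc 4 (by norm_num)
  have hcpt : IsCompact (closedBall a (χ.rOut * R)) := isCompact_closedBall _ _
  have hei : Integrable ((closedBall a (χ.rOut * R)).indicator fun y =>
      ‖fderiv ℝ (curl v) y‖ ^ 2 + (L / R) ^ 2 * ‖curl v y‖ ^ 2) :=
    (integrable_indicator_iff measurableSet_closedBall).2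
      (((hDωc.norm.pow 2).add (continuous_const.mul (hωc.norm.pow 2))).continuousOn.integrableOn_compact
        hcpt)
  -- left-hand side as `ofReal` of a Bochner integral
  have hl : ∫⁻ x, ‖(χ : (EuclideanSpace ℝ (Fin 3)) → ℝ) (R⁻¹ • (x - a)) • curl v x‖ₑ ^ 4 =
      ENNReal.ofReal (∫ x, ‖(χ : (EuclideanSpace ℝ (Fin 3)) → ℝ) (R⁻¹ • (x - a)) • curl v x‖ ^ 4) := by
    rw [ofReal_integral_eq_lintegral_ofReal h4i (ae_of_all _ fun x => by positivity)]
    refine lintegral_congr fun x => ?_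
    rw [← ofReal_norm, ENNReal.ofReal_pow (norm_nonneg _)]
  -- right-hand side as `ofReal` of a Bochner integral
  have hr : ∫⁻ x, (closedBall a (χ.rOut * R)).indicator
        (fun y => ENNReal.ofReal (‖fderiv ℝ (curl v) y‖ ^ 2 + (L / R) ^ 2 * ‖curl v y‖ ^ 2)) x =
      ENNReal.ofReal (∫ x in closedBall a (χ.rOut * R),
        (‖fderiv ℝ (curl v) x‖ ^ 2 + (L / R) ^ 2 * ‖curl v x‖ ^ 2)) := by
    rw [← integral_indicator measurableSet_closedBall,
      ofReal_integral_eq_lintegral_ofReal hei (ae_of_all _ fun x =>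
        indicator_nonneg (fun y _ => by positivity) _)]
    refine lintegral_congr fun x => ?_
    by_cases hx : x ∈ closedBall a (χ.rOut * R)
    · rw [indicator_of_mem hx, indicator_of_mem hx]
    · rw [indicator_of_notMem hx, indicator_of_notMem hx, ENNReal.ofReal_zero]
  rw [hl, hr, ← ENNReal.ofReal_mul (by positivity)]
  exact ENNReal.ofReal_le_ofReal hreal

/-- **Centre integral of the `L⁴` masses**: if every centre obeys
`∫‖g_a‖ₑ⁴ ≤ ofReal c · ∫ 1_{closedBall a r} ofReal e`, then
`∫_a ∫‖g_a‖ₑ⁴ ≤ ofReal c · |closedBall 0 r| · ofReal ∫ e` (Tonelli). [folklore] -/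
theorem lintegral_lintegral_loc_pow_four_le (χ : ContDiffBump (0 : (EuclideanSpace ℝ (Fin 3))))
    {R c : ℝ} (hR : 0 < R) {e : EuclideanSpace ℝ (Fin 3) → ℝ} (hec : Continuous e)
    (hei : Integrable e) (he0 : ∀ x, 0 ≤ e x)
    (h : ∀ a, ∫⁻ x, ‖(χ : (EuclideanSpace ℝ (Fin 3)) → ℝ) (R⁻¹ • (x - a)) • curl v x‖ₑ ^ 4 ≤
      ENNReal.ofReal c * ∫⁻ x, (closedBall a (χ.rOut * R)).indicator
        (fun y => ENNReal.ofReal (e y)) x) :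
    ∫⁻ a, ∫⁻ x, ‖(χ : (EuclideanSpace ℝ (Fin 3)) → ℝ) (R⁻¹ • (x - a)) • curl v x‖ₑ ^ 4 ≤
      ENNReal.ofReal c * (volume (closedBall (0 : EuclideanSpace ℝ (Fin 3)) (χ.rOut * R)) *
        ENNReal.ofReal (∫ x, e x)) := by
  have hr : 0 ≤ χ.rOut * R := (mul_pos χ.rOut_pos hR).le
  have hem : Measurable fun y => ENNReal.ofReal (e y) := ENNReal.measurable_ofReal.comp hec.measurable
  calc ∫⁻ a, ∫⁻ x, ‖(χ : (EuclideanSpace ℝ (Fin 3)) → ℝ) (R⁻¹ • (x - a)) • curl v x‖ₑ ^ 4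
      ≤ ∫⁻ a, ENNReal.ofReal c * ∫⁻ x, (closedBall a (χ.rOut * R)).indicator
          (fun y => ENNReal.ofReal (e y)) x := lintegral_mono h
    _ = ENNReal.ofReal c * (volume (closedBall (0 : EuclideanSpace ℝ (Fin 3)) (χ.rOut * R)) *
          ∫⁻ x, ENNReal.ofReal (e x)) := by
        rw [lintegral_const_mul' _ _ ENNReal.ofReal_ne_top,
          lintegral_lintegral_indicator_closedBall hr hem]
    _ = ENNReal.ofReal c * (volume (closedBall (0 : EuclideanSpace ℝ (Fin 3)) (χ.rOut * R)) *
          ENNReal.ofReal (∫ x, e x)) := by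
        rw [ofReal_integral_eq_lintegral_ofReal hei (ae_of_all _ he0)]

/-- **Centre integral of the local gradient masses**:
`∫_a ∫ 1_{closedBall a r} ‖Dv‖ₑ² ≤ |closedBall 0 r| · ofReal ∫|curl v|²` for a divergence-free `C²`
field `v ∈ L²` with `curl v ∈ L²` (Tonelli + `‖Dv‖ ≤ |Dv|_F` + the tree's `L²` `div`–`curl`
estimate `∫|Dv|²_F ≤ ∫|curl v|²`). [folklore] -/
theorem lintegral_lintegral_ball_fderiv_le (hv : ContDiff ℝ 2 v) (hdiv : VectorCalculus.IsDivFree v)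
    (hL2 : ∫⁻ x, ‖v x‖ₑ ^ 2 < ⊤) (hZi : Integrable (fun x => ‖curl v x‖ ^ 2)) {r : ℝ}
    (hr : 0 ≤ r) :
    ∫⁻ a, ∫⁻ x, (closedBall a r).indicator (fun y => ‖fderiv ℝ v y‖ₑ ^ 2) x ≤
      volume (closedBall (0 : EuclideanSpace ℝ (Fin 3)) r) * ENNReal.ofReal (∫ x, ‖curl v x‖ ^ 2) := by
  have hm : Measurable fun y => ‖fderiv ℝ v y‖ₑ ^ 2 :=
    ((hv.continuous_fderiv (by norm_num)).measurable.enorm).pow_const _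
  rw [lintegral_lintegral_indicator_closedBall hr hm]
  gcongr
  calc ∫⁻ y, ‖fderiv ℝ v y‖ₑ ^ 2 ≤ ∫⁻ y, ENNReal.ofReal (frobeniusNormSq (fderiv ℝ v y)) := by
        refine lintegral_mono fun y => ?_
        rw [← ofReal_norm, ← ENNReal.ofReal_pow (norm_nonneg _)]
        exact ENNReal.ofReal_le_ofReal (sq_opNorm_le_frobeniusNormSq _)
    _ ≤ ∫⁻ y, ‖curl v y‖ₑ ^ 2 := lintegral_frobeniusNormSq_fderiv_le_lintegral_sq_norm_curl hv hdiv hL2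
    _ = ENNReal.ofReal (∫ x, ‖curl v x‖ ^ 2) := by
        rw [ofReal_integral_eq_lintegral_ofReal hZi (ae_of_all _ fun x => by positivity)]
        refine lintegral_congr fun x => ?_
        rw [← ofReal_norm, ENNReal.ofReal_pow (norm_nonneg _)]

end Estimates

/-! ### The closing real inequality -/

/-- The closing algebra: `ε Z^{3/4} P^{3/4} ≤ S ≤ 8 √(2K³√(δZ)√(2P(1+L²δ))(1+L²)PZ)` is impossible
once `δ ≤ min 1 (ε⁴ / (4 (C₂+1)²))`, `C₂ = 128 K³ (1+L²) √(2(1+L²))`. [folklore] -/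
theorem final_algebra {ε Z P K L δ S : ℝ} (hε : 0 < ε) (hZ : 0 < Z) (hP : 0 < P) (hK : 0 ≤ K)
    (hδ1 : δ ≤ 1) (hδ0 : 0 ≤ δ)
    (hδ : δ ≤ ε ^ 4 / (4 * (128 * K ^ 3 * (1 + L ^ 2) * Real.sqrt (2 * (1 + L ^ 2)) + 1) ^ 2))
    (h1 : ε * Z ^ (3 / 4 : ℝ) * P ^ (3 / 4 : ℝ) ≤ S)
    (h2 : S ≤ 8 * Real.sqrt (2 * K ^ 3 * Real.sqrt (δ * Z) * Real.sqrt (2 * (P * (1 + L ^ 2 * δ))) *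
      (1 + L ^ 2) * P * Z)) :
    False := by
  set C₂ : ℝ := 128 * K ^ 3 * (1 + L ^ 2) * Real.sqrt (2 * (1 + L ^ 2)) with hC₂
  have hC₂0 : 0 ≤ C₂ := by positivity
  -- `√δ ≤ ε² / (2 (C₂ + 1))`
  have hsq : Real.sqrt δ ≤ ε ^ 2 / (2 * (C₂ + 1)) := by
    have h := Real.sqrt_le_sqrt hδ
    have he : Real.sqrt (ε ^ 4 / (4 * (C₂ + 1) ^ 2)) = ε ^ 2 / (2 * (C₂ + 1)) := by
      rw [show ε ^ 4 / (4 * (C₂ + 1) ^ 2) = (ε ^ 2 / (2 * (C₂ + 1))) ^ 2 by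
          rw [div_pow]; congr 1 <;> ring,
        Real.sqrt_sq (by positivity)]
    rwa [he] at h
  -- the three-quarter powers
  have h34 : ∀ {x : ℝ}, 0 < x → (x ^ (3 / 4 : ℝ)) ^ 2 = x * Real.sqrt x := by
    intro x hx
    rw [← Real.rpow_natCast, ← Real.rpow_mul hx.le, show (3 / 4 : ℝ) * ((2 : ℕ) : ℝ) = 1 + 1 / 2 by
      norm_num, Real.rpow_add hx, Real.rpow_one, Real.sqrt_eq_rpow]
  set W : ℝ := Z * Real.sqrt Z * (P * Real.sqrt P) with hW
  have hW0 : 0 < W := by positivity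
  -- square the chain
  have h0 : 0 ≤ ε * Z ^ (3 / 4 : ℝ) * P ^ (3 / 4 : ℝ) := by positivity
  set X : ℝ := 2 * K ^ 3 * Real.sqrt (δ * Z) * Real.sqrt (2 * (P * (1 + L ^ 2 * δ))) *
      (1 + L ^ 2) * P * Z with hX
  have hX0 : 0 ≤ X := by positivity
  have h3 : (ε * Z ^ (3 / 4 : ℝ) * P ^ (3 / 4 : ℝ)) ^ 2 ≤ (8 * Real.sqrt X) ^ 2 :=
    pow_le_pow_left₀ h0 (h1.trans h2) 2
  have hL : ε ^ 2 * W = (ε * Z ^ (3 / 4 : ℝ) * P ^ (3 / 4 : ℝ)) ^ 2 := by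
    rw [mul_pow, mul_pow, h34 hZ, h34 hP, hW]; ring
  have hR : (8 * Real.sqrt X) ^ 2 = 64 * X := by
    rw [mul_pow, Real.sq_sqrt hX0]; norm_num
  -- bound `64 X ≤ C₂ √δ W`
  have hs1 : Real.sqrt (δ * Z) = Real.sqrt δ * Real.sqrt Z := Real.sqrt_mul hδ0 Z
  have hs2 : Real.sqrt (2 * (P * (1 + L ^ 2 * δ))) = Real.sqrt P * Real.sqrt (2 * (1 + L ^ 2 * δ)) := by
    rw [show 2 * (P * (1 + L ^ 2 * δ)) = P * (2 * (1 + L ^ 2 * δ)) by ring, Real.sqrt_mul hP.le]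
  have hs3 : Real.sqrt (2 * (1 + L ^ 2 * δ)) ≤ Real.sqrt (2 * (1 + L ^ 2)) :=
    Real.sqrt_le_sqrt (by nlinarith [sq_nonneg L])
  have h64 : 64 * X ≤ C₂ * Real.sqrt δ * W := by
    have e : 64 * X = 128 * K ^ 3 * (1 + L ^ 2) * Real.sqrt (2 * (1 + L ^ 2 * δ)) *
        Real.sqrt δ * W := by
      rw [hX, hs1, hs2, hW]; ring
    rw [e, hC₂]
    have hrest : 0 ≤ 128 * K ^ 3 * (1 + L ^ 2) * (Real.sqrt δ * W) := by positivity
    calc 128 * K ^ 3 * (1 + L ^ 2) * Real.sqrt (2 * (1 + L ^ 2 * δ)) * Real.sqrt δ * W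
        = Real.sqrt (2 * (1 + L ^ 2 * δ)) * (128 * K ^ 3 * (1 + L ^ 2) * (Real.sqrt δ * W)) := by
          ring
      _ ≤ Real.sqrt (2 * (1 + L ^ 2)) * (128 * K ^ 3 * (1 + L ^ 2) * (Real.sqrt δ * W)) :=
          mul_le_mul_of_nonneg_right hs3 hrest
      _ = 128 * K ^ 3 * (1 + L ^ 2) * Real.sqrt (2 * (1 + L ^ 2)) * Real.sqrt δ * W := by ring
  have h4 : ε ^ 2 * W ≤ C₂ * Real.sqrt δ * W := by
    calc ε ^ 2 * W = (ε * Z ^ (3 / 4 : ℝ) * P ^ (3 / 4 : ℝ)) ^ 2 := hL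
      _ ≤ (8 * Real.sqrt X) ^ 2 := h3
      _ = 64 * X := hR
      _ ≤ C₂ * Real.sqrt δ * W := h64
  have h5 : ε ^ 2 ≤ C₂ * Real.sqrt δ := le_of_mul_le_mul_right h4 hW0
  have h6 : ε ^ 2 ≤ C₂ * (ε ^ 2 / (2 * (C₂ + 1))) :=
    h5.trans (mul_le_mul_of_nonneg_left hsq hC₂0)
  have hε2 : 0 < ε ^ 2 := by positivity
  have h7 : C₂ * (ε ^ 2 / (2 * (C₂ + 1))) < ε ^ 2 := by
    rw [mul_div_assoc', div_lt_iff₀ (by positivity)]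
    nlinarith
  exact absurd (h6.trans_lt h7) (lt_irrefl _)



end EfficiencyConcentration

end Summit.NavierStokesRegularity.NavierStokesRegularity.Theorems

end
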